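/-
Copyright (c) 2026 the pub-hodgecm-mathlib formalisation cell (harness21).  Prover seat hodgecm-mathlib-K2-defs1 (g5), Track B ∕ K2-LIT,
h413 = `stmt-HodgeConjecture-24833`, line `K2_E1_TraceFormulaBeta`, page «EIS-WHITTAKER-2», dealer K2E1-plan (g4) LAST DEAL «W-ARCH-DECAY» (2026-09-04T07:55:40Z):
the archimedean Whittaker factor `Γ(z)⁻¹·√(π∕c)·𝓜[e^{−u−π²t²∕(cu)}](z − ½)` is holomorphic on `Re z > ½` and decays like `e^{−(π∕√c)|t|}`, locally uniformly in `z`.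
-/
import Summits.HodgeConjecture.HodgeConjecture.Theorems.K2E1ArchWhittakerContinuation     -- ★ p858148 (K2E3-p12 g5): `…_eq_mellin` :216, `differentiable_mellin_expKernel` :267, `norm_mellin_expKernel_le` :303
import Summits.HodgeConjecture.HodgeConjecture.Theorems.K2E1WhittakerSeriesConvergenceU2   -- ★ p858248 (K2E1-p09 g5), §1 only: `exists_exp_neg_mul_rpow_le_rpow_neg` (exp ⟶ poly currency)
import Mathlib.Analysis.SpecialFunctions.Gamma.Deriv                                      -- `Complex.GammaIntegral_eq_mellin`, `Complex.hasDerivAt_GammaIntegral` (the `t = 0` fibre)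
import Mathlib.NumberTheory.NumberField.InfinitePlace.TotallyRealComplex
import HarnessLib

/-!
# h413 ∕ Track B «K2-LIT», «EIS-WHITTAKER-2» — `K2E1ArchWhittakerDecayUniformU2` («W-ARCH-DECAY»): the archimedean Whittaker factor
# `𝓦(c,z,t) = Γ(z)⁻¹·√(π∕c)·𝓜[u ↦ e^{−u−π²t²∕(cu)}](z − ½)` is holomorphic on `{½ < Re z}` (entire for `t ≠ 0`) and `‖𝓦(c,z,t)‖ ≤ C_V·e^{−(π∕√c)|t|}` near every `z₀`, `Re z₀ > ½`

Cell `pub/hodgecm-mathlib`, crux H413 = `stmt-HodgeConjecture-24833`, route `HCCMUnconditional`; dealer K2E1-plan (g4), LAST DEAL 07:55:40Z «W-ARCH-DECAY» (= file B of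
K2E3-p12 (g6)'s «W-hWbd» cut 07:55:29Z, typed here by arrangement; consumers: K2E3-p12 (g6) `K2E1WhittakerBoundsAssemblyU2`, K2E4-p14 (g6) «W5-FINAL»).  THEOREMS ONLY (no
`def`, no `instance`, no `notation`, no named-fact hypothesis, no `sorry`; default heartbeats); lane `--kind proof --supports stmt-HodgeConjecture-24833 --as helper` (count-neutral).
LETTERS FROZEN to ★ p858148 `K2E1ArchWhittakerContinuation.integral_onePlusSqPow_mul_phase_eq_mellin` :216: for `c > 0` (the real-place parameter `c_w = −σ_w(δ²)`), `z : ℂ` and a REAL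
frequency `t` (`= η_w`), the archimedean Whittaker factor is ALWAYS spelled out as
`(Complex.Gamma z)⁻¹ * ((Real.sqrt (π / c) : ℝ) : ℂ) * mellin (fun u : ℝ => Complex.exp (-(u : ℂ) - ((π ^ 2 * t ^ 2 / c : ℝ) : ℂ) / (u : ℂ))) (z - 1 / 2)`
(`= ∫_ℝ (1 + c s²)^{−z} e^{−2πits} ds` for `Re z > ½`, ★ :216; written `𝓦(c,z,t)` in prose only).

THE MATHEMATICS (Bump §3.7; Garrett §1.10; the campaign's WIRING TABLE «W5-FINAL» rows `hWhol`∕`hWbd`).  (§1) `Γ(z)⁻¹` is entire (Mathlib `Complex.differentiable_one_div_Gamma`), hence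
bounded on every compact set — in particular on the closed disc `V = B̄(z₀, r)`, `r = (Re z₀ − ½)∕2`, on which `x₀ := Re z₀ − r ≤ Re z ≤ Re z₀ + r =: x₁` with `x₀ > ½`
(`|Re(z − z₀)| ≤ ‖z − z₀‖`); `Γ(z)⁻¹` is NOT bounded on vertical strips, so the neighbourhood must be a box∕disc, not a strip.  (§2) ★ :303 bounds the Mellin factor on the strip
`x₀ ≤ Re z ≤ x₁` by `I(x₀,x₁)·e^{−√A}`, `I = ∫_0^∞ (u^{x₀−3∕2} + u^{x₁−3∕2}) e^{−3u∕4} du`, `A = π²t²∕c`, and `√A = (π∕√c)·|t|` — so on `V`: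
`‖𝓦(c,z,t)‖ ≤ C_Γ(V)·√(π∕c)·I(x₀,x₁)·e^{−(π∕√c)|t|}` with the EXPLICIT rate `b_c = π∕√c` (exposed, no `∃ b`, so the assembly can compare `Σ_w b_{c_w}|η_w|` with `b‖ξ_∞‖`).
(§3) Over the finitely many real places (`ι` finite, `c t : ι → ℝ`): `‖∏_i 𝓦(c_i,z,t_i)‖ ≤ (∏ C_i)·e^{−Σ_i (π∕√c_i)|t_i|}` on `⋂ V_i`; with `b ≤ min_i π∕√c_i` and the sup norm
`‖t‖ ≤ Σ|t_i|` this is `≤ C·e^{−b‖t‖}` (W5-A's exponential currency, `a = 0`) and, by ★ W4 `exists_exp_neg_mul_rpow_le_rpow_neg`, `≤ M·(1+‖t‖)^{−k}` for every `k` (W4's polynomial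
currency); `‖x‖_{mixedSpace K} = ‖x.1‖` for `K` totally real (empty complex part) converts the assembly's `‖ι(ξ)_∞‖`.  (§4) HOLOMORPHY: for `t ≠ 0` (`A > 0`) the factor is ENTIRE
(★ :267 × `Γ⁻¹` entire); for `t = 0` the kernel is `e^{−u}`, `𝓜[e^{−u}](z − ½) = GammaIntegral(z − ½)` (Mathlib `Complex.GammaIntegral_eq_mellin`) is holomorphic where `Re(z − ½) > 0`
(Mathlib `Complex.hasDerivAt_GammaIntegral`) — so `z ↦ 𝓦(c,z,t)` is `DifferentiableOn {½ < Re}` for EVERY `t`, and so are the finite products.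

* §1 `exists_forall_norm_Gamma_inv_le`, `re_mem_Icc_of_mem_closedBall`.
* §2 `sqrt_pi_sq_mul_sq_div`, `setIntegral_stripMajorant_nonneg`, `norm_archWhittaker_le_of_re_mem_Icc`, **`exists_nhds_forall_norm_archWhittaker_le`** (rate `π∕√c` explicit),
  `exists_nhds_forall_norm_archWhittaker_le_exp_neg` (the dealer's `∃ C b` letter).
* §3 **`exists_nhds_forall_norm_prod_archWhittaker_le`** (`e^{−Σ_i (π∕√c_i)|t_i|}`), `exists_pos_forall_le_pi_div_sqrt`, `norm_le_sum_abs`,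
  **`exists_nhds_forall_norm_prod_archWhittaker_le_exp_neg_norm`** (`e^{−b‖t‖}`), **`exists_nhds_forall_norm_prod_archWhittaker_le_rpow_neg`** (`(1+‖t‖)^{−k}`),
  `norm_eq_norm_fst_of_isTotallyReal` (`‖x‖_{mixedSpace K} = ‖x.1‖`).
* §4 **`differentiable_archWhittaker`** (`t ≠ 0`: entire), **`differentiableOn_archWhittaker`** (every `t`, on `{½ < Re}`), `differentiable_prod_archWhittaker`, `differentiableOn_prod_archWhittaker`.
HONEST LABEL.  Count-neutral helper; proves no printed statement; HC_CM is proved only modulo the 7 printed citations (2 remaining named inputs: hLiu418 =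
`stmt-HodgeConjecture-24832`, h413 = `stmt-HodgeConjecture-24833`) until rung 0 closes.

## References
* [Bump1997] D. Bump, *Automorphic Forms and Representations* (1997), §1.6 (1.26)–(1.27), §3.7 (archimedean Whittaker functions of Eisenstein series; `K`-Bessel decay).
* [Garrett2018] P. Garrett, *Modern Analysis of Automorphic Forms by Example* 1 (2018), §1.9–§1.10.
-/

set_option autoImplicit false
set_option linter.dupNamespace false  -- the mandated namespace repeats the summit's segment (`HodgeConjecture.HodgeConjecture`)

noncomputable section

open MeasureTheory Filter Topology Set Real
open scoped NNReal
open NumberField NumberField.InfinitePlace NumberField.mixedEmbedding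
open Summit.HodgeConjecture.HodgeConjecture.Cruxes.H413.K2E1ArchWhittakerContinuation (differentiable_mellin_expKernel norm_mellin_expKernel_le)
open Summit.HodgeConjecture.HodgeConjecture.Cruxes.H413.K2E1WhittakerSeriesConvergenceU2 (exists_exp_neg_mul_rpow_le_rpow_neg)

namespace Summit.HodgeConjecture.HodgeConjecture.Cruxes.H413.K2E1ArchWhittakerDecayUniformU2

/-! ## §1 `Γ(z)⁻¹` on compact sets; the disc `B̄(z₀, r)` sits in the strip `Re z₀ − r ≤ Re z ≤ Re z₀ + r` -/

/-- **`Γ(z)⁻¹` is bounded on every compact set** (it is entire: Mathlib `Complex.differentiable_one_div_Gamma`; `IsCompact.exists_bound_of_continuousOn`). [cite: Bump1997, §3.7] -/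
theorem exists_forall_norm_Gamma_inv_le {S : Set ℂ} (hS : IsCompact S) : ∃ C : ℝ, 0 ≤ C ∧ ∀ z ∈ S, ‖(Complex.Gamma z)⁻¹‖ ≤ C := by
  obtain ⟨C, hC⟩ := hS.exists_bound_of_continuousOn Complex.differentiable_one_div_Gamma.continuous.continuousOn
  exact ⟨max C 0, le_max_right _ _, fun z hz => (hC z hz).trans (le_max_left _ _)⟩

/-- On the closed disc `B̄(z₀, r)` the real part stays in `[Re z₀ − r, Re z₀ + r]` (`|Re(z − z₀)| ≤ ‖z − z₀‖`). [folklore] -/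
theorem re_mem_Icc_of_mem_closedBall {z z₀ : ℂ} {r : ℝ} (hz : z ∈ Metric.closedBall z₀ r) : z₀.re - r ≤ z.re ∧ z.re ≤ z₀.re + r := by
  have h : |z.re - z₀.re| ≤ r := by
    have h1 := Complex.abs_re_le_norm (z - z₀)
    rw [Complex.sub_re] at h1
    exact h1.trans (mem_closedBall_iff_norm.mp hz)
  obtain ⟨h₁, h₂⟩ := abs_le.mp h
  constructor <;> linarith

/-! ## §2 One real place: `‖𝓦(c,z,t)‖ ≤ C_V·e^{−(π∕√c)|t|}` near `z₀` -/

/-- `√(π²t²∕c) = (π∕√c)·|t|` — the decay exponent `√A` of ★ `norm_mellin_expKernel_le` at `A = π²t²∕c`. [folklore] -/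
theorem sqrt_pi_sq_mul_sq_div {c : ℝ} (hc : 0 < c) (t : ℝ) : Real.sqrt (π ^ 2 * t ^ 2 / c) = π / Real.sqrt c * |t| := by
  rw [show π ^ 2 * t ^ 2 = (π * t) ^ 2 by ring, Real.sqrt_div (sq_nonneg _), Real.sqrt_sq_eq_abs, abs_mul, abs_of_pos Real.pi_pos]
  have : 0 < Real.sqrt c := Real.sqrt_pos.mpr hc
  ring

/-- The strip constant `I(x₀,x₁) = ∫_0^∞ (u^{x₀−3∕2} + u^{x₁−3∕2})·e^{−3u∕4} du` of ★ `norm_mellin_expKernel_le` is `≥ 0`. [folklore] -/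
theorem setIntegral_stripMajorant_nonneg (x₀ x₁ : ℝ) : 0 ≤ ∫ u in Ioi (0 : ℝ), (u ^ (x₀ - 3 / 2) + u ^ (x₁ - 3 / 2)) * Real.exp (-(3 / 4 * u)) :=
  setIntegral_nonneg measurableSet_Ioi fun u (hu : 0 < u) => by positivity

/-- **Strip bound at one place**: for `½ < x₀ ≤ Re z ≤ x₁`,
`‖𝓦(c,z,t)‖ ≤ ‖Γ(z)⁻¹‖·√(π∕c)·I(x₀,x₁)·e^{−(π∕√c)|t|}` (★ `norm_mellin_expKernel_le` at `A = π²t²∕c ≥ 0`). [cite: Bump1997, §3.7] [cite: Garrett2018, §1.10] -/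
theorem norm_archWhittaker_le_of_re_mem_Icc {c : ℝ} (hc : 0 < c) {x₀ x₁ : ℝ} (hx₀ : 1 / 2 < x₀) {z : ℂ} (h₀ : x₀ ≤ z.re) (h₁ : z.re ≤ x₁) (t : ℝ) :
    ‖(Complex.Gamma z)⁻¹ * ((Real.sqrt (π / c) : ℝ) : ℂ) * mellin (fun u : ℝ => Complex.exp (-(u : ℂ) - ((π ^ 2 * t ^ 2 / c : ℝ) : ℂ) / (u : ℂ))) (z - 1 / 2)‖ ≤
      ‖(Complex.Gamma z)⁻¹‖ * Real.sqrt (π / c) * (∫ u in Ioi (0 : ℝ), (u ^ (x₀ - 3 / 2) + u ^ (x₁ - 3 / 2)) * Real.exp (-(3 / 4 * u))) *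
        Real.exp (-(π / Real.sqrt c * |t|)) := by
  have hm := norm_mellin_expKernel_le (A := π ^ 2 * t ^ 2 / c) (by positivity) hx₀ h₀ h₁
  rw [sqrt_pi_sq_mul_sq_div hc t] at hm
  calc ‖(Complex.Gamma z)⁻¹ * ((Real.sqrt (π / c) : ℝ) : ℂ) * mellin (fun u : ℝ => Complex.exp (-(u : ℂ) - ((π ^ 2 * t ^ 2 / c : ℝ) : ℂ) / (u : ℂ))) (z - 1 / 2)‖
        = ‖(Complex.Gamma z)⁻¹‖ * Real.sqrt (π / c) * ‖mellin (fun u : ℝ => Complex.exp (-(u : ℂ) - ((π ^ 2 * t ^ 2 / c : ℝ) : ℂ) / (u : ℂ))) (z - 1 / 2)‖ := by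
          rw [norm_mul, norm_mul, Complex.norm_real, Real.norm_of_nonneg (Real.sqrt_nonneg _)]
    _ ≤ ‖(Complex.Gamma z)⁻¹‖ * Real.sqrt (π / c) *
          ((∫ u in Ioi (0 : ℝ), (u ^ (x₀ - 3 / 2) + u ^ (x₁ - 3 / 2)) * Real.exp (-(3 / 4 * u))) * Real.exp (-(π / Real.sqrt c * |t|))) := by gcongr
    _ = _ := by ring

/-- **THE LOCAL UNIFORM DECAY AT ONE REAL PLACE** (rate EXPLICIT): for `c > 0` and `Re z₀ > ½` there are a neighbourhood `V` of `z₀` (the closed disc of radius `(Re z₀ − ½)∕2`) and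
`C ≥ 0` with `‖𝓦(c,z,t)‖ ≤ C·e^{−(π∕√c)|t|}` for all `z ∈ V` and ALL real `t`. [cite: Bump1997, §3.7] [cite: Garrett2018, §1.10] -/
theorem exists_nhds_forall_norm_archWhittaker_le {c : ℝ} (hc : 0 < c) {z₀ : ℂ} (hz₀ : 1 / 2 < z₀.re) :
    ∃ V ∈ 𝓝 z₀, ∃ C : ℝ, 0 ≤ C ∧ ∀ z ∈ V, ∀ t : ℝ,
      ‖(Complex.Gamma z)⁻¹ * ((Real.sqrt (π / c) : ℝ) : ℂ) * mellin (fun u : ℝ => Complex.exp (-(u : ℂ) - ((π ^ 2 * t ^ 2 / c : ℝ) : ℂ) / (u : ℂ))) (z - 1 / 2)‖ ≤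
        C * Real.exp (-(π / Real.sqrt c * |t|)) := by
  set r : ℝ := (z₀.re - 1 / 2) / 2 with hr
  have hr0 : 0 < r := by rw [hr]; linarith
  have hx₀ : 1 / 2 < z₀.re - r := by rw [hr]; linarith
  obtain ⟨CΓ, hCΓ0, hCΓ⟩ := exists_forall_norm_Gamma_inv_le (isCompact_closedBall z₀ r)
  refine ⟨Metric.closedBall z₀ r, Metric.closedBall_mem_nhds z₀ hr0,
    CΓ * Real.sqrt (π / c) * ∫ u in Ioi (0 : ℝ), (u ^ (z₀.re - r - 3 / 2) + u ^ (z₀.re + r - 3 / 2)) * Real.exp (-(3 / 4 * u)),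
    mul_nonneg (mul_nonneg hCΓ0 (Real.sqrt_nonneg _)) (setIntegral_stripMajorant_nonneg _ _), fun z hz t => ?_⟩
  obtain ⟨h₀, h₁⟩ := re_mem_Icc_of_mem_closedBall hz
  have hI := setIntegral_stripMajorant_nonneg (z₀.re - r) (z₀.re + r)
  calc ‖(Complex.Gamma z)⁻¹ * ((Real.sqrt (π / c) : ℝ) : ℂ) * mellin (fun u : ℝ => Complex.exp (-(u : ℂ) - ((π ^ 2 * t ^ 2 / c : ℝ) : ℂ) / (u : ℂ))) (z - 1 / 2)‖
        ≤ ‖(Complex.Gamma z)⁻¹‖ * Real.sqrt (π / c) * (∫ u in Ioi (0 : ℝ), (u ^ (z₀.re - r - 3 / 2) + u ^ (z₀.re + r - 3 / 2)) * Real.exp (-(3 / 4 * u))) *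
            Real.exp (-(π / Real.sqrt c * |t|)) := norm_archWhittaker_le_of_re_mem_Icc hc hx₀ h₀ h₁ t
    _ ≤ CΓ * Real.sqrt (π / c) * (∫ u in Ioi (0 : ℝ), (u ^ (z₀.re - r - 3 / 2) + u ^ (z₀.re + r - 3 / 2)) * Real.exp (-(3 / 4 * u))) *
            Real.exp (-(π / Real.sqrt c * |t|)) := by gcongr; exact hCΓ z hz

/-- The dealer's letter (`∃ C b`): `‖𝓦(c,z,t)‖ ≤ C·e^{−b|t|}` near `z₀` with SOME `b > 0` (namely `π∕√c`). [cite: Bump1997, §3.7] -/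
theorem exists_nhds_forall_norm_archWhittaker_le_exp_neg {c : ℝ} (hc : 0 < c) {z₀ : ℂ} (hz₀ : 1 / 2 < z₀.re) :
    ∃ V ∈ 𝓝 z₀, ∃ C b : ℝ, 0 ≤ C ∧ 0 < b ∧ ∀ z ∈ V, ∀ t : ℝ,
      ‖(Complex.Gamma z)⁻¹ * ((Real.sqrt (π / c) : ℝ) : ℂ) * mellin (fun u : ℝ => Complex.exp (-(u : ℂ) - ((π ^ 2 * t ^ 2 / c : ℝ) : ℂ) / (u : ℂ))) (z - 1 / 2)‖ ≤
        C * Real.exp (-(b * |t|)) := by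
  obtain ⟨V, hV, C, hC0, hC⟩ := exists_nhds_forall_norm_archWhittaker_le hc hz₀
  exact ⟨V, hV, C, π / Real.sqrt c, hC0, div_pos Real.pi_pos (Real.sqrt_pos.mpr hc), hC⟩

/-! ## §3 The finitely many real places: products, the sup norm, both currencies -/

/-- **PRODUCT OVER THE REAL PLACES**: for `c_i > 0` and `Re z₀ > ½` there are `V ∈ 𝓝 z₀` and `C ≥ 0` with
`‖∏_i 𝓦(c_i,z,t_i)‖ ≤ C·e^{−Σ_i (π∕√c_i)|t_i|}` for all `z ∈ V`, `t : ι → ℝ` (`V = ⋂ V_i`, `C = ∏ C_i`, `Real.exp_sum`). [cite: Bump1997, §3.7] -/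
theorem exists_nhds_forall_norm_prod_archWhittaker_le {ι : Type*} [Fintype ι] {c : ι → ℝ} (hc : ∀ i, 0 < c i) {z₀ : ℂ} (hz₀ : 1 / 2 < z₀.re) :
    ∃ V ∈ 𝓝 z₀, ∃ C : ℝ, 0 ≤ C ∧ ∀ z ∈ V, ∀ t : ι → ℝ,
      ‖∏ i, (Complex.Gamma z)⁻¹ * ((Real.sqrt (π / c i) : ℝ) : ℂ) *
          mellin (fun u : ℝ => Complex.exp (-(u : ℂ) - ((π ^ 2 * t i ^ 2 / c i : ℝ) : ℂ) / (u : ℂ))) (z - 1 / 2)‖ ≤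
        C * Real.exp (-(∑ i, π / Real.sqrt (c i) * |t i|)) := by
  classical
  choose V hV C hC0 hC using fun i => exists_nhds_forall_norm_archWhittaker_le (hc i) hz₀
  refine ⟨⋂ i, V i, Filter.iInter_mem.2 hV, ∏ i, C i, Finset.prod_nonneg fun i _ => hC0 i, fun z hz t => ?_⟩
  have heq : (∏ i, C i) * Real.exp (-(∑ i, π / Real.sqrt (c i) * |t i|)) = ∏ i, (C i * Real.exp (-(π / Real.sqrt (c i) * |t i|))) := by
    rw [Finset.prod_mul_distrib, ← Real.exp_sum, ← Finset.sum_neg_distrib]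
  rw [norm_prod, heq]
  exact Finset.prod_le_prod (fun i _ => norm_nonneg _) fun i _ => hC i z (Set.mem_iInter.mp hz i) (t i)

/-- A common decay rate: some `b > 0` with `b ≤ π∕√c_i` for all `i` (the minimum over the finitely many places; `b = 1` if there are none). [folklore] -/
theorem exists_pos_forall_le_pi_div_sqrt {ι : Type*} [Fintype ι] {c : ι → ℝ} (hc : ∀ i, 0 < c i) : ∃ b : ℝ, 0 < b ∧ ∀ i, b ≤ π / Real.sqrt (c i) := by
  classical
  by_cases hι : Nonempty ι
  · obtain ⟨i₀, -, hi₀⟩ := Finset.exists_min_image Finset.univ (fun i => π / Real.sqrt (c i)) (Finset.univ_nonempty_iff.mpr hι)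
    exact ⟨π / Real.sqrt (c i₀), div_pos Real.pi_pos (Real.sqrt_pos.mpr (hc i₀)), fun i => hi₀ i (Finset.mem_univ i)⟩
  · exact ⟨1, one_pos, fun i => (hι ⟨i⟩).elim⟩

/-- The sup norm of a real vector is at most the sum of the moduli of its entries. [folklore] -/
theorem norm_le_sum_abs {ι : Type*} [Fintype ι] (t : ι → ℝ) : ‖t‖ ≤ ∑ i, |t i| := by
  refine (pi_norm_le_iff_of_nonneg (Finset.sum_nonneg fun i _ => abs_nonneg (t i))).2 fun i => ?_
  rw [Real.norm_eq_abs]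
  exact Finset.single_le_sum (fun j _ => abs_nonneg (t j)) (Finset.mem_univ i)

/-- **EXPONENTIAL CURRENCY** (W5-A's `hWbd` with `a = 0`): for `0 ≤ b ≤ min_i π∕√c_i`, `‖∏_i 𝓦(c_i,z,t_i)‖ ≤ C·e^{−b‖t‖}` for `z ∈ V ∈ 𝓝 z₀` and every `t : ι → ℝ` (sup norm).
[cite: Bump1997, §3.7] [cite: Garrett2018, §1.10] -/
theorem exists_nhds_forall_norm_prod_archWhittaker_le_exp_neg_norm {ι : Type*} [Fintype ι] {c : ι → ℝ} (hc : ∀ i, 0 < c i) {b : ℝ} (hb0 : 0 ≤ b)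
    (hb : ∀ i, b ≤ π / Real.sqrt (c i)) {z₀ : ℂ} (hz₀ : 1 / 2 < z₀.re) :
    ∃ V ∈ 𝓝 z₀, ∃ C : ℝ, 0 ≤ C ∧ ∀ z ∈ V, ∀ t : ι → ℝ,
      ‖∏ i, (Complex.Gamma z)⁻¹ * ((Real.sqrt (π / c i) : ℝ) : ℂ) *
          mellin (fun u : ℝ => Complex.exp (-(u : ℂ) - ((π ^ 2 * t i ^ 2 / c i : ℝ) : ℂ) / (u : ℂ))) (z - 1 / 2)‖ ≤
        C * Real.exp (-(b * ‖t‖)) := by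
  obtain ⟨V, hV, C, hC0, hC⟩ := exists_nhds_forall_norm_prod_archWhittaker_le hc hz₀
  refine ⟨V, hV, C, hC0, fun z hz t => (hC z hz t).trans (mul_le_mul_of_nonneg_left ?_ hC0)⟩
  rw [Real.exp_le_exp, neg_le_neg_iff]
  calc b * ‖t‖ ≤ b * ∑ i, |t i| := mul_le_mul_of_nonneg_left (norm_le_sum_abs t) hb0
    _ = ∑ i, b * |t i| := Finset.mul_sum _ _ _
    _ ≤ ∑ i, π / Real.sqrt (c i) * |t i| := Finset.sum_le_sum fun i _ => mul_le_mul_of_nonneg_right (hb i) (abs_nonneg _)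

/-- **POLYNOMIAL CURRENCY** (W4's `hWbd`): for every `k`, `‖∏_i 𝓦(c_i,z,t_i)‖ ≤ M·(1+‖t‖)^{−k}` for `z ∈ V ∈ 𝓝 z₀` and every `t` (★ W4 `exists_exp_neg_mul_rpow_le_rpow_neg`).
[cite: Bump1997, §3.7] -/
theorem exists_nhds_forall_norm_prod_archWhittaker_le_rpow_neg {ι : Type*} [Fintype ι] {c : ι → ℝ} (hc : ∀ i, 0 < c i) {z₀ : ℂ} (hz₀ : 1 / 2 < z₀.re) (k : ℝ) :
    ∃ V ∈ 𝓝 z₀, ∃ M : ℝ, 0 ≤ M ∧ ∀ z ∈ V, ∀ t : ι → ℝ,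
      ‖∏ i, (Complex.Gamma z)⁻¹ * ((Real.sqrt (π / c i) : ℝ) : ℂ) *
          mellin (fun u : ℝ => Complex.exp (-(u : ℂ) - ((π ^ 2 * t i ^ 2 / c i : ℝ) : ℂ) / (u : ℂ))) (z - 1 / 2)‖ ≤
        M * (1 + ‖t‖) ^ (-k) := by
  obtain ⟨b, hb0, hb⟩ := exists_pos_forall_le_pi_div_sqrt hc
  obtain ⟨V, hV, C, hC0, hC⟩ := exists_nhds_forall_norm_prod_archWhittaker_le_exp_neg_norm hc hb0.le hb hz₀
  obtain ⟨M, hM0, hM⟩ := exists_exp_neg_mul_rpow_le_rpow_neg hb0 0 k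
  refine ⟨V, hV, C * M, mul_nonneg hC0 hM0, fun z hz t => (hC z hz t).trans ?_⟩
  have h := hM ‖t‖ (norm_nonneg t)
  rw [Real.rpow_zero, mul_one] at h
  calc C * Real.exp (-(b * ‖t‖)) ≤ C * (M * (1 + ‖t‖) ^ (-k)) := mul_le_mul_of_nonneg_left h hC0
    _ = C * M * (1 + ‖t‖) ^ (-k) := (mul_assoc _ _ _).symm

open scoped Classical in
/-- For a TOTALLY REAL `K` the mixed space `(K_∞ ≅) ({w real} → ℝ) × ({w complex} → ℂ)` has empty complex part, so `‖x‖ = ‖x.1‖` (the sup over the real places) — converting the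
assembly's `‖ι(ξ)_∞‖ = ‖ringEquiv_mixedSpace K (ι ξ)_∞‖` to the real vector of §3. [folklore] -/
theorem norm_eq_norm_fst_of_isTotallyReal (K : Type) [Field K] [NumberField K] [IsTotallyReal K] (x : mixedSpace K) : ‖x‖ = ‖x.1‖ := by
  haveI : IsEmpty {w : InfinitePlace K // IsComplex w} := ⟨fun w => (not_isComplex_iff_isReal.mpr (IsTotallyReal.isReal w.1)) w.2⟩
  rw [Prod.norm_def, Subsingleton.elim x.2 0, norm_zero, max_eq_left (norm_nonneg _)]

/-! ## §4 Holomorphy in `z`: entire for `t ≠ 0`, `DifferentiableOn {½ < Re}` for every `t` -/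

/-- **ENTIRE for `t ≠ 0`**: `z ↦ 𝓦(c,z,t)` is differentiable on all of `ℂ` (`A = π²t²∕c > 0`: ★ `differentiable_mellin_expKernel` composed with `z ↦ z − ½`, times the entire `Γ⁻¹`).
[cite: Bump1997, §1.6, §3.7] [cite: Garrett2018, §1.10] -/
theorem differentiable_archWhittaker {c : ℝ} (hc : 0 < c) {t : ℝ} (ht : t ≠ 0) :
    Differentiable ℂ fun z : ℂ => (Complex.Gamma z)⁻¹ * ((Real.sqrt (π / c) : ℝ) : ℂ) *
      mellin (fun u : ℝ => Complex.exp (-(u : ℂ) - ((π ^ 2 * t ^ 2 / c : ℝ) : ℂ) / (u : ℂ))) (z - 1 / 2) := by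
  have hA : 0 < π ^ 2 * t ^ 2 / c := div_pos (mul_pos (pow_pos Real.pi_pos 2) (pow_pos (abs_pos.mpr ht) 2 |>.trans_eq (sq_abs t))) hc
  exact (Complex.differentiable_one_div_Gamma.mul_const _).mul ((differentiable_mellin_expKernel hA).comp (differentiable_id.sub_const _))

/-- **HOLOMORPHIC ON `{½ < Re z}` FOR EVERY `t`** (W5-A's `hWhol` letter `U = {z | 1∕2 < z.re}`): for `t ≠ 0` by the previous lemma; for `t = 0` the kernel is `e^{−u}` and
`𝓜[e^{−u}](z − ½) = GammaIntegral (z − ½)` (Mathlib `Complex.GammaIntegral_eq_mellin`), holomorphic where `Re (z − ½) > 0` (Mathlib `Complex.hasDerivAt_GammaIntegral`).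
[cite: Bump1997, §3.7] -/
theorem differentiableOn_archWhittaker {c : ℝ} (hc : 0 < c) (t : ℝ) :
    DifferentiableOn ℂ (fun z : ℂ => (Complex.Gamma z)⁻¹ * ((Real.sqrt (π / c) : ℝ) : ℂ) *
      mellin (fun u : ℝ => Complex.exp (-(u : ℂ) - ((π ^ 2 * t ^ 2 / c : ℝ) : ℂ) / (u : ℂ))) (z - 1 / 2)) {z : ℂ | 1 / 2 < z.re} := by
  by_cases ht : t = 0
  · subst ht
    have hker : (fun u : ℝ => Complex.exp (-(u : ℂ) - ((π ^ 2 * (0 : ℝ) ^ 2 / c : ℝ) : ℂ) / (u : ℂ))) = fun u : ℝ => ((Real.exp (-u) : ℝ) : ℂ) := by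
      funext u
      rw [Complex.ofReal_exp, Complex.ofReal_neg]
      congr 1
      simp
    intro z hz
    have hz' : 0 < (z - 1 / 2).re := by
      have : (z - 1 / 2 : ℂ).re = z.re - 1 / 2 := by simp [Complex.sub_re]
      rw [this]
      exact sub_pos.mpr hz
    have hmel : DifferentiableAt ℂ (fun w : ℂ => mellin (fun u : ℝ => Complex.exp (-(u : ℂ) - ((π ^ 2 * (0 : ℝ) ^ 2 / c : ℝ) : ℂ) / (u : ℂ))) (w - 1 / 2)) z := by
      have heq : (fun w : ℂ => mellin (fun u : ℝ => Complex.exp (-(u : ℂ) - ((π ^ 2 * (0 : ℝ) ^ 2 / c : ℝ) : ℂ) / (u : ℂ))) (w - 1 / 2)) =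
          fun w : ℂ => Complex.GammaIntegral (w - 1 / 2) := by
        funext w
        rw [hker, Complex.GammaIntegral_eq_mellin]
      rw [heq]
      have h2 := ((Complex.hasDerivAt_GammaIntegral hz').comp z ((hasDerivAt_id z).sub_const (1 / 2 : ℂ))).differentiableAt
      exact h2
    exact (((Complex.differentiable_one_div_Gamma z).mul_const _).mul hmel).differentiableWithinAt
  · exact (differentiable_archWhittaker hc ht).differentiableOn

/-- Products over the real places are entire when all `t_i ≠ 0` (Mathlib `Differentiable.fun_finsetProd`). [cite: Bump1997, §3.7] -/
theorem differentiable_prod_archWhittaker {ι : Type*} [Fintype ι] {c : ι → ℝ} (hc : ∀ i, 0 < c i) {t : ι → ℝ} (ht : ∀ i, t i ≠ 0) :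
    Differentiable ℂ fun z : ℂ => ∏ i, (Complex.Gamma z)⁻¹ * ((Real.sqrt (π / c i) : ℝ) : ℂ) *
      mellin (fun u : ℝ => Complex.exp (-(u : ℂ) - ((π ^ 2 * t i ^ 2 / c i : ℝ) : ℂ) / (u : ℂ))) (z - 1 / 2) := by
  classical
  exact Differentiable.fun_finsetProd fun i _ => differentiable_archWhittaker (hc i) (ht i)

/-- Products over the real places are holomorphic on `{½ < Re z}` for every `t` (Mathlib `DifferentiableOn.fun_finsetProd`). [cite: Bump1997, §3.7] -/
theorem differentiableOn_prod_archWhittaker {ι : Type*} [Fintype ι] {c : ι → ℝ} (hc : ∀ i, 0 < c i) (t : ι → ℝ) :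
    DifferentiableOn ℂ (fun z : ℂ => ∏ i, (Complex.Gamma z)⁻¹ * ((Real.sqrt (π / c i) : ℝ) : ℂ) *
      mellin (fun u : ℝ => Complex.exp (-(u : ℂ) - ((π ^ 2 * t i ^ 2 / c i : ℝ) : ℂ) / (u : ℂ))) (z - 1 / 2)) {z : ℂ | 1 / 2 < z.re} := by
  classical
  exact DifferentiableOn.fun_finsetProd fun i _ => differentiableOn_archWhittaker (hc i) (t i)

end Summit.HodgeConjecture.HodgeConjecture.Cruxes.H413.K2E1ArchWhittakerDecayUniformU2

end
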